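import Summits.KontsevichZagierPeriods.KontsevichZagierPeriods.Theses.HurwitzMicroSectors
import Literature.NumberTheory.Transcendental.BoxCoordinatePowerMap

/-! # Disproof of `DilationMove` (stmt-KontsevichZagierPeriods-3872, route HurwitzMicroSectors) — findings

VERDICT (cycles 1–3, 2026-08-16): **the crux RESISTS — it is TRUE as typed.** §P below is a sorry-free
proof `dilationMove_holds : DilationMove` (axioms `propext, Classical.choice, Quot.sound`; witness
`Φ x = (xᵢ^m)ᵢ`, `Φ' x = diagCLM (i ↦ m·xᵢ^(m-1)) = ContinuousLinearMap.pi (i ↦ (m·xᵢ^(m-1)) • proj i)`);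
an independent candidate proof (`BoxDilation.lean`, refuter g41-26, 2026-08-15) is attached to the
item as evidence. No kill is possible. What this file records instead: WHY every hypothesis is
there (each one dropped gives a false statement, §A), that the Jacobian factor is the UNIQUE
monomial making the move valid (§B), and which variants are false (§A/§C). The only refutation
channel is soundness of the calculus (`KZ.eval_eq_zero_of_mem_changeOfVariablesRel_holds`,
packaged as `value_eq_of_mem`): a change-of-variables relation `[r] − [r']` forces
`r.value = r'.value`; all witnesses are monomial reps `[(a,b), c·t^k]` in dimension 1.

* §0  kit: interval boxes `(a,b)ⁿ` with rational corners are `ℚ`-semialgebraic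
      (`isSemialgebraic_ibox`); monomial reps `monoRep a b c k = [(a,b), c·t^k]` in dimension 1 and
      their values `c·∫_a^b t^k` (`value_monoRep`, `value_monoRep_unit = c/(k+1)`).
* families: `DilationMoveBoxes n m a b a' b'` (domains varied) and `DilationMoveJac n m c k`
      (Jacobian factor `c·∏xᵢ^k`); anchors `dilationMove_iff_boxes`, `dilationMove_iff_jac`
      (the crux = member `(0,1),(0,1)` resp. `(mⁿ, m−1)`, for all `n`, `m ≥ 1`).
* §A  load-bearing hypotheses — each is necessary ("any proof must use H"):
      `dilationMove_false_without_oneLe`    ⟸ `not_dilationMoveJac_zero` (m = 0, n = 1: the typed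
          factor `0¹·t^(0-1)` is `0`, so `r = [(0,1), 0]`, `r' = [(0,1), 1]` pass; values 0 ≠ 1);
      `dilationMove_false_without_source`   ⟸ `not_dilationMoveBoxes_source` (source `(0,2)`, 2 ≠ 1);
      `dilationMove_false_without_target`   ⟸ `not_dilationMoveBoxes_target` (target `(0,2)`, 1 ≠ 2);
      `dilationMove_false_without_jacobian` ⟸ `not_dilationMoveJac_noJacobian` (factor 1, m = 2:
          `r' = [(0,1), t]`, `r = [(0,1), t²]`, 1/3 ≠ 1/2);
      `not_dilationMoveBoxes_shifted` — both boxes `(1,2)`, m = 2 (`Φ''σ ≠ σ`: 0 and 1 are the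
          fixed points of `t ↦ t^m`, the unit box is the only interval box that works): 3 ≠ 1;
      `not_dilationMoveBoxes_symm` — both boxes `(-1,1)`, m = 2 (non-injective, signed Jacobian):
          0 ≠ 2.
* §P  `dilationMove_holds` with reusable pieces `det_diagCLM` (`det diag(c) = ∏ cᵢ` via
      `Matrix.toLin'`/`det_diagonal`), `hasFDerivAt_powMap` (`hasFDerivAt_pi` + `HasFDerivAt.pow`),
      `image_powMap_box` (`Real.rpow_inv_natCast_pow`), `injOn_powMap_box` (`pow_left_inj₀`).
* §B  tightness: `dilationMoveJac_one_iff` — in dimension 1 the move with factor `c·t^k`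
      (`c ∈ ℚ`, `k ∈ ℕ`, `m ≥ 1`) holds IFF `(c, k) = (m, m − 1)`; necessity by two test
      integrands (`r' = 1` forces `c = k+1`; `r' = t` forces `k = m−1`), sufficiency = §P.
* §C  variants NOT refutable: the closed box `[0,1]ⁿ` version is PROVED (`dilationMoveClosed_holds`:
      openness is not load-bearing); §C′ the distinct-exponent version `xᵢ ↦ xᵢ^(mᵢ)`, `mᵢ ≥ 1`,
      factor `∏ mᵢ·xᵢ^(mᵢ-1)` is PROVED (`dilationMoveMulti_holds`, and the crux is its uniform case
      `dilationMove_of_multi`); true by the same proof (triagers' W.lean / Scratch.lean, not here):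
      any semialgebraic `σ ⊆ (0,∞)ⁿ` with `r'.domain = Φ''σ` (card orthant-coordpow-move).
      Degenerate `n = 0`: true (one point, `Φ = id`, factor `m⁰·1 = 1`).
* §D  (cycle 2) TIGHTNESS IN ALL DIMENSIONS — the constant `mⁿ` is dimension-dependent:
      `prodRep n c k = [(0,1)ⁿ, c·∏ xᵢ^k]`, `value_prodRep = c/(k+1)ⁿ` (Fubini: `volume_pi`,
      `Measure.restrict_pi_pi`, `integral_fintype_prod_eq_pow`); `dilationMoveJac_necessary` /
      `dilationMoveJac_iff` — for `n ≥ 1` and EVERY `m : ℕ`, factor `c·∏ xᵢ^k` is valid iff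
      `c = mⁿ ∧ k + 1 = m` (tests `r' = 1`, `r' = ∏ xᵢ`, then injectivity of `t ↦ tⁿ`); corollaries
      `not_dilationMoveJac_zero_exp` (m = 0 dead in every dimension for every factor),
      `not_dilationMoveJac_two_two_linear` (`2·xy` is NOT a move at (n,m) = (2,2): the `4` in
      `H_r + H_(r+3) ∼ 4H_(2r+1)` is `2²`), `not_dilationMoveJac_noConstant` (`∏ xᵢ^(m-1)` alone fails,
      m ≥ 2), the consumer instances `dilationMoveJac_two_two_iff` (c = 4, k = 1),
      `dilationMoveJac_two_three_iff` (c = 9, k = 2), `dilationMoveJac_three_two_iff` (c = 8, k = 1),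
      and the junk dimension `dilationMoveJac_zero_iff` (n = 0: valid iff c = 1, any m, k).
* §E  (cycle 3) TARGETS = the two registered stubs of the PICKED line `coordpow-api-assembly`:
      BOTH TRUE (`stub_isSemialgebraicMapOn_coordPow_holds`, `stub_orthantCoordPowMove_holds`,
      composed in `dilationMove_of_targets`) — nothing to break. Load-bearing analysis of stub 2:
      the orthant hypothesis is necessary EXACTLY for even `m` (`CoordPowMoveAnyDomain`;
      `not_coordPowMoveAnyDomain_one_even`: `r = [(-1,1), m·t^(m-1)]`, `r' = [[0,1), 1]` with the
      HONEST image `Φₘ''(-1,1) = [0,1)`, values 0 ≠ 1 — the signed Jacobian of the 2-to-1 map cancels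
      the sheets; `coordPowMoveAnyDomain_of_odd`: odd `m` needs no orthant at all, any domain, any `n`;
      `coordPowMoveAnyDomain_one_iff_odd`; `orthantCoordPowMove_false_without_orthant`), and the CLOSED
      orthant suffices (`coordPowMove_of_subset_closedOrthant`). Filed as Negative/StubOrthant.lean.
* Targets (payload): none stuck (stuck_stubs empty); the skeleton's stubs are attacked in §E.
* §F  (cycle 3) DOMAIN SHAPE family `DilationMoveOn n m D` (source = target = `D`): valid for every
      `Φₘ`-stable `D` in the closed orthant (`dilationMoveOn_of_image_eq`; unit box = crux; ORDERED
      simplex `dilationMoveOn_orderedSimplex`, all `m ≥ 1` ⇒ sibling stmt-9436 SimplexDilationMove is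
      true), INVALID for the STANDARD simplex `{x,y>0, x+y<1}` at `(n,m) = (2,2)`
      (`not_dilationMoveOn_stdSimplex_two_two`: `r' = [S,1]`, `r = [S,4xy]`, `∫_S 4xy < ∫_S 1` strictly;
      `Φ₂''S = {√u+√v<1} ≠ S`) ⇒ the image clause of stub 2 cannot be weakened to `r'.domain = r.domain`
      (`not_forall_dilationMoveOn_orthant`). Filed as Negative/DomainShape.lean.
* Regimes tried for a kill, all dead: m = 1 (identity, factor 1 — fine), n = 0 (fine), truncated
  `m - 1` at m = 1 (t⁰ = 1 — fine), `|det| = det` (positivity on the OPEN box — fine), exact image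
  `Φ''(0,1)ⁿ = (0,1)ⁿ` (m-th roots — fine), `r = r'` (then `[r] − [r'] = 0 ∈ changeOfVariablesRel`
  via the same witness — fine), free-abelian-group bookkeeping (`of r − of r' = of r₀ − of r₀'` is
  witnessed with `(r₀, r₀') = (r, r')` — fine).
-/

noncomputable section

set_option linter.dupNamespace false

open MeasureTheory Set MvPolynomial intervalIntegral
open Literature.NumberTheory.Transcendental Literature.ModelTheory.ExponentialFields

namespace Summit.KontsevichZagierPeriods.KontsevichZagierPeriods.Cruxes.DilationMove.Disproof

open Summit.KontsevichZagierPeriods.KontsevichZagierPeriods.Theses.HurwitzMicroSectors (DilationMove)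

/-! ## §0 Kit -/

/-- The open interval box `(a,b)ⁿ ⊆ ℝⁿ` with rational corners, in the shape typed in the crux.
[folklore] -/
def ibox (n : ℕ) (a b : ℚ) : Set (Fin n → ℝ) := {x | ∀ i, x i ∈ Ioo (a : ℝ) b}

/-- The unit box of the crux is `ibox n 0 1`. [folklore] -/
theorem ibox_zero_one (n : ℕ) : ibox n 0 1 = {x : Fin n → ℝ | ∀ i, x i ∈ Ioo (0 : ℝ) 1} := by
  simp [ibox]

/-- Interval boxes with rational corners are `ℚ`-semialgebraic. [folklore] -/
theorem isSemialgebraic_ibox (n : ℕ) (a b : ℚ) : IsSemialgebraic ℚ (ibox n a b) := by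
  have h : ∀ i : Fin n, IsSemialgebraic ℚ {x : Fin n → ℝ | x i ∈ Ioo (a : ℝ) b} := by
    intro i
    have h1 := (isSemialgebraic_setOf_eval_lt (k := ℚ) (R := ℝ) (ι := Fin n) (C a) (X i)).inter
      (isSemialgebraic_setOf_eval_lt (k := ℚ) (R := ℝ) (ι := Fin n) (X i) (C b))
    have hEq : {x : Fin n → ℝ | x i ∈ Ioo (a : ℝ) b} =
        {x : Fin n → ℝ | aeval x (C a : MvPolynomial (Fin n) ℚ) < aeval x (X i : MvPolynomial (Fin n) ℚ)} ∩
        {x : Fin n → ℝ | aeval x (X i : MvPolynomial (Fin n) ℚ) < aeval x (C b : MvPolynomial (Fin n) ℚ)} := by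
      ext x
      simp
    rw [hEq]
    exact h1
  have hEq : ibox n a b = ⋂ i ∈ (Finset.univ : Finset (Fin n)), {x : Fin n → ℝ | x i ∈ Ioo (a : ℝ) b} := by
    ext x
    simp [ibox]
  rw [hEq]
  exact IsSemialgebraic.biInter _ _ fun i _ => h i

/-- `ibox n a b ⊆ [a,b]ⁿ`. [folklore] -/
theorem ibox_subset_Icc (n : ℕ) (a b : ℚ) :
    ibox n a b ⊆ Icc (fun _ => (a : ℝ)) (fun _ => (b : ℝ)) := by
  intro x hx
  exact ⟨fun i => (hx i).1.le, fun i => (hx i).2.le⟩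

/-- The monomial representation `[(a,b), t ↦ c·t^k]` in dimension 1 (`c ∈ ℚ`). [folklore] -/
def monoRep (a b c : ℚ) (k : ℕ) : KZ.IntegralRep 1 where
  domain := ibox 1 a b
  integrand := fun x => (c : ℝ) * x 0 ^ k
  isSemialgebraic_domain := isSemialgebraic_ibox 1 a b
  isSemialgebraicFunOn_integrand :=
    (isSemialgebraicFunOn_aeval (isSemialgebraic_ibox 1 a b) (C c * X 0 ^ k)).congr
      (fun x _ => by simp)
  integrableOn :=
    ((continuous_const.mul ((continuous_apply 0).pow k)).continuousOn.integrableOn_compact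
      isCompact_Icc).mono_set (ibox_subset_Icc 1 a b)

/-- Auxiliary: `monoRep_domain`. [folklore] -/
@[simp] theorem monoRep_domain (a b c : ℚ) (k : ℕ) : (monoRep a b c k).domain = ibox 1 a b := rfl

/-- Auxiliary: `monoRep_integrand`. [folklore] -/
@[simp] theorem monoRep_integrand (a b c : ℚ) (k : ℕ) :
    (monoRep a b c k).integrand = fun x => (c : ℝ) * x 0 ^ k := rfl

/-- The 1-box is the preimage of the interval under `x ↦ x 0`. [folklore] -/
theorem ibox_one_eq_preimage (a b : ℚ) :
    ibox 1 a b = (MeasurableEquiv.funUnique (Fin 1) ℝ) ⁻¹' Ioo (a : ℝ) b := by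
  ext x
  simp [ibox, Fin.forall_fin_one, MeasurableEquiv.funUnique]

/-- Value of a monomial representation: `c · ∫_a^b t^k dt`. [folklore] -/
theorem value_monoRep (a b c : ℚ) (k : ℕ) (hab : (a : ℝ) ≤ b) :
    (monoRep a b c k).value = c * ∫ t in (a : ℝ)..b, t ^ k := by
  have h := (volume_preserving_funUnique (Fin 1) ℝ).setIntegral_preimage_emb
      (MeasurableEquiv.measurableEmbedding _) (fun t : ℝ => (c : ℝ) * t ^ k) (Ioo (a : ℝ) b)
  rw [KZ.IntegralRep.value, monoRep_domain, monoRep_integrand, ibox_one_eq_preimage]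
  have h' : (fun x : Fin 1 → ℝ => (c : ℝ) * x 0 ^ k) =
      fun x => (c : ℝ) * (MeasurableEquiv.funUnique (Fin 1) ℝ) x ^ k := by
    funext x
    simp [MeasurableEquiv.funUnique]
  rw [h']
  refine h.trans ?_
  rw [intervalIntegral.integral_of_le hab, integral_Ioc_eq_integral_Ioo]
  exact integral_const_mul _ _

/-- THE REFUTATION CHANNEL: a change-of-variables relation `[r] − [r']` forces equal values
(soundness, `KZ.eval_eq_zero_of_mem_changeOfVariablesRel_holds`). [folklore] -/
theorem value_eq_of_mem {n : ℕ} {r r' : KZ.IntegralRep n}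
    (h : KZ.of r - KZ.of r' ∈ KZ.changeOfVariablesRel) : r.value = r'.value := by
  have := KZ.eval_eq_zero_of_mem_changeOfVariablesRel_holds h
  rwa [map_sub, KZ.eval_of, KZ.eval_of, sub_eq_zero] at this

/-! ## The two parametrised families around the crux -/

/-- FAMILY 1 (domains). The crux at fixed `(n, m)` with the source box `(a,b)ⁿ` and the target box
`(a',b')ⁿ` in place of `(0,1)ⁿ`, `(0,1)ⁿ`. [folklore] -/
def DilationMoveBoxes (n m : ℕ) (a b a' b' : ℚ) : Prop :=
  ∀ (r r' : KZ.IntegralRep n), r.domain = ibox n a b → r'.domain = ibox n a' b' →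
    (∀ x ∈ r.domain, r.integrand x =
      r'.integrand (fun i => x i ^ m) * ((m : ℝ) ^ n * ∏ i, x i ^ (m - 1))) →
    KZ.of r - KZ.of r' ∈ KZ.changeOfVariablesRel

/-- FAMILY 2 (Jacobian). The crux at fixed `(n, m)` with the Jacobian factor `mⁿ · ∏ᵢ xᵢ^(m-1)`
replaced by `c · ∏ᵢ xᵢ^k` (`c ∈ ℚ`, `k ∈ ℕ`); no constraint on `m`. [folklore] -/
def DilationMoveJac (n m : ℕ) (c : ℚ) (k : ℕ) : Prop :=
  ∀ (r r' : KZ.IntegralRep n), r.domain = {x | ∀ i, x i ∈ Ioo (0 : ℝ) 1} →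
    r'.domain = {x | ∀ i, x i ∈ Ioo (0 : ℝ) 1} →
    (∀ x ∈ r.domain, r.integrand x = r'.integrand (fun i => x i ^ m) * ((c : ℝ) * ∏ i, x i ^ k)) →
    KZ.of r - KZ.of r' ∈ KZ.changeOfVariablesRel

/-- ANCHOR 1: the crux is the member `(0,1), (0,1)` of family 1, for all `n` and `m ≥ 1`.
[folklore] -/
theorem dilationMove_iff_boxes :
    DilationMove ↔ ∀ n m : ℕ, 1 ≤ m → DilationMoveBoxes n m 0 1 0 1 := by
  simp only [DilationMove, DilationMoveBoxes, ibox_zero_one]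

/-- ANCHOR 2: the crux is the member `(c, k) = (mⁿ, m − 1)` of family 2, for all `n` and `m ≥ 1`.
[folklore] -/
theorem dilationMove_iff_jac :
    DilationMove ↔ ∀ n m : ℕ, 1 ≤ m → DilationMoveJac n m ((m : ℚ) ^ n) (m - 1) := by
  simp only [DilationMove, DilationMoveJac, Rat.cast_pow, Rat.cast_natCast]

/-! ## §A Load-bearing hypotheses -/

/-- Master lemma for family 1 in dimension 1: a pair of monomial witnesses with different values
kills `DilationMoveBoxes 1 m a b a' b'`. [folklore] -/
theorem not_boxes_of_witness {m : ℕ} {a b a' b' : ℚ} (c : ℚ) (k : ℕ) (c' : ℚ) (k' : ℕ)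
    (hrel : ∀ x : Fin 1 → ℝ, (∀ i, x i ∈ Ioo (a : ℝ) b) →
      (c : ℝ) * x 0 ^ k = (c' : ℝ) * (x 0 ^ m) ^ k' * ((m : ℝ) ^ 1 * ∏ i, x i ^ (m - 1)))
    (hne : (monoRep a b c k).value ≠ (monoRep a' b' c' k').value) :
    ¬ DilationMoveBoxes 1 m a b a' b' := by
  intro h
  refine hne (value_eq_of_mem (h (monoRep a b c k) (monoRep a' b' c' k') rfl rfl ?_))
  intro x hx
  simpa using hrel x hx

/-- **Source domain is load-bearing.** With the source box `(0,2)` (target `(0,1)`, `m = 1`,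
identity map and Jacobian `1`) the statement is false: `r = [ (0,2), 1 ]`, `r' = [ (0,1), 1 ]` satisfy
the integrand relation but have values `2 ≠ 1`. [folklore] -/
theorem not_dilationMoveBoxes_source : ¬ DilationMoveBoxes 1 1 0 2 0 1 := by
  refine not_boxes_of_witness 1 0 1 0 (fun x _ => by simp) ?_
  rw [value_monoRep 0 2 1 0 (by norm_num), value_monoRep 0 1 1 0 (by norm_num)]
  norm_num

/-- **Target domain is load-bearing.** With the target box `(0,2)` (source `(0,1)`, `m = 1`) the
statement is false: values `1 ≠ 2`. [folklore] -/
theorem not_dilationMoveBoxes_target : ¬ DilationMoveBoxes 1 1 0 1 0 2 := by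
  refine not_boxes_of_witness 1 0 1 0 (fun x _ => by simp) ?_
  rw [value_monoRep 0 1 1 0 (by norm_num), value_monoRep 0 2 1 0 (by norm_num)]
  norm_num

/-- **`Φ '' (0,1)ⁿ = (0,1)ⁿ` is load-bearing** (the unit box is special: `0, 1` are the fixed points
of `t ↦ t^m`). On the box `(1,2)` with `m = 2`: `r = [ (1,2), 2t ]`, `r' = [ (1,2), 1 ]` satisfy the
relation, values `3 ≠ 1`. [folklore] -/
theorem not_dilationMoveBoxes_shifted : ¬ DilationMoveBoxes 1 2 1 2 1 2 := by
  refine not_boxes_of_witness 2 1 1 0 (fun x _ => by simp) ?_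
  rw [value_monoRep 1 2 2 1 (by norm_num), value_monoRep 1 2 1 0 (by norm_num)]
  norm_num [integral_pow]

/-- **Positivity of the box is load-bearing** (`t ↦ t²` is not injective on `(-1,1)` and the signed
Jacobian `2t` is not `|2t|`): `r = [ (-1,1), 2t ]`, `r' = [ (-1,1), 1 ]`, values `0 ≠ 2`. [folklore] -/
theorem not_dilationMoveBoxes_symm : ¬ DilationMoveBoxes 1 2 (-1) 1 (-1) 1 := by
  refine not_boxes_of_witness 2 1 1 0 (fun x _ => by simp) ?_
  rw [value_monoRep (-1) 1 2 1 (by norm_num), value_monoRep (-1) 1 1 0 (by norm_num)]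
  norm_num [integral_pow]

/-- Master lemma for family 2 in dimension 1. [folklore] -/
theorem not_jac_of_witness {m : ℕ} {c₀ : ℚ} {k₀ : ℕ} (c : ℚ) (k : ℕ) (c' : ℚ) (k' : ℕ)
    (hrel : ∀ x : Fin 1 → ℝ, (∀ i, x i ∈ Ioo (0 : ℝ) 1) →
      (c : ℝ) * x 0 ^ k = (c' : ℝ) * (x 0 ^ m) ^ k' * ((c₀ : ℝ) * ∏ i, x i ^ k₀))
    (hne : (monoRep 0 1 c k).value ≠ (monoRep 0 1 c' k').value) :
    ¬ DilationMoveJac 1 m c₀ k₀ := by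
  intro h
  refine hne (value_eq_of_mem (h (monoRep 0 1 c k) (monoRep 0 1 c' k')
    (by simp [ibox]) (by simp [ibox]) ?_))
  intro x hx
  have hx' : ∀ i, x i ∈ Ioo (0 : ℝ) 1 := by simpa [ibox] using hx
  simpa using hrel x hx'

/-- Value of the unit-interval monomial rep: `c / (k + 1)`. [folklore] -/
theorem value_monoRep_unit (c : ℚ) (k : ℕ) : (monoRep 0 1 c k).value = c / (k + 1) := by
  rw [value_monoRep 0 1 c k (by norm_num)]
  push_cast
  rw [integral_pow]
  simp [div_eq_mul_inv]

/-- **`1 ≤ m` is load-bearing.** At `m = 0` (n = 1) the typed Jacobian factor is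
`0¹ · x^(0-1) = 0`, so the relation reads `r.integrand = 0` with `r'` arbitrary on the box:
`r = [ (0,1), 0 ]`, `r' = [ (0,1), 1 ]`, values `0 ≠ 1`. Hence the crux without `1 ≤ m` is false.
[folklore] -/
theorem not_dilationMoveJac_zero : ¬ DilationMoveJac 1 0 ((0 : ℚ) ^ 1) (0 - 1) := by
  refine not_jac_of_witness 0 0 1 0 (fun x _ => by simp) ?_
  rw [value_monoRep_unit, value_monoRep_unit]
  norm_num

/-- The crux with the hypothesis `1 ≤ m` DELETED (everything else verbatim). -/
def DilationMoveWithoutOneLe : Prop :=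
  ∀ (n m : ℕ) (r r' : KZ.IntegralRep n), r.domain = {x | ∀ i, x i ∈ Ioo (0 : ℝ) 1} →
    r'.domain = {x | ∀ i, x i ∈ Ioo (0 : ℝ) 1} →
    (∀ x ∈ r.domain, r.integrand x =
      r'.integrand (fun i => x i ^ m) * ((m : ℝ) ^ n * ∏ i, x i ^ (m - 1))) →
    KZ.of r - KZ.of r' ∈ KZ.changeOfVariablesRel

/-- Any proof of the crux must use `1 ≤ m`. [folklore] -/
theorem dilationMove_false_without_oneLe : ¬ DilationMoveWithoutOneLe := by
  intro h
  refine not_dilationMoveJac_zero fun r r' hr hr' hrel => h 1 0 r r' hr hr' ?_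
  intro x hx
  simpa using hrel x hx

/-- The crux with the source-domain hypothesis `r.domain = (0,1)ⁿ` DELETED (everything else verbatim). -/
def DilationMoveWithoutSource : Prop :=
  ∀ (n m : ℕ), 1 ≤ m → ∀ (r r' : KZ.IntegralRep n),
    r'.domain = {x | ∀ i, x i ∈ Ioo (0 : ℝ) 1} →
    (∀ x ∈ r.domain, r.integrand x =
      r'.integrand (fun i => x i ^ m) * ((m : ℝ) ^ n * ∏ i, x i ^ (m - 1))) →
    KZ.of r - KZ.of r' ∈ KZ.changeOfVariablesRel

/-- Any proof of the crux must use `r.domain = (0,1)ⁿ`. [folklore] -/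
theorem dilationMove_false_without_source : ¬ DilationMoveWithoutSource := by
  intro h
  refine not_dilationMoveBoxes_source fun r r' _ hr' hrel => h 1 1 le_rfl r r' ?_ hrel
  rw [hr', ibox_zero_one]

/-- The crux with the target-domain hypothesis `r'.domain = (0,1)ⁿ` DELETED (everything else verbatim). -/
def DilationMoveWithoutTarget : Prop :=
  ∀ (n m : ℕ), 1 ≤ m → ∀ (r r' : KZ.IntegralRep n),
    r.domain = {x | ∀ i, x i ∈ Ioo (0 : ℝ) 1} →
    (∀ x ∈ r.domain, r.integrand x =
      r'.integrand (fun i => x i ^ m) * ((m : ℝ) ^ n * ∏ i, x i ^ (m - 1))) →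
    KZ.of r - KZ.of r' ∈ KZ.changeOfVariablesRel

/-- Any proof of the crux must use `r'.domain = (0,1)ⁿ`. [folklore] -/
theorem dilationMove_false_without_target : ¬ DilationMoveWithoutTarget := by
  intro h
  refine not_dilationMoveBoxes_target fun r r' hr _ hrel => h 1 1 le_rfl r r' ?_ hrel
  rw [hr, ibox_zero_one]

/-- The crux with the Jacobian factor DELETED from the integrand relation
(`r.integrand x = r'.integrand (xᵢ^m)ᵢ`; everything else verbatim). -/
def DilationMoveWithoutJacobian : Prop :=
  ∀ (n m : ℕ), 1 ≤ m → ∀ (r r' : KZ.IntegralRep n),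
    r.domain = {x | ∀ i, x i ∈ Ioo (0 : ℝ) 1} → r'.domain = {x | ∀ i, x i ∈ Ioo (0 : ℝ) 1} →
    (∀ x ∈ r.domain, r.integrand x = r'.integrand (fun i => x i ^ m)) →
    KZ.of r - KZ.of r' ∈ KZ.changeOfVariablesRel

/-- **The Jacobian factor is load-bearing**: factor `1 = 1·x⁰` at `m = 2`, `n = 1` is false
(`r' = [ (0,1), t ]`, `r = [ (0,1), t² ]`, values `1/3 ≠ 1/2`). [folklore] -/
theorem not_dilationMoveJac_noJacobian : ¬ DilationMoveJac 1 2 1 0 := by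
  refine not_jac_of_witness 1 2 1 1 (fun x _ => by simp) ?_
  rw [value_monoRep_unit, value_monoRep_unit]
  norm_num

/-- Any proof of the crux must use the Jacobian factor. [folklore] -/
theorem dilationMove_false_without_jacobian : ¬ DilationMoveWithoutJacobian := by
  intro h
  refine not_dilationMoveJac_noJacobian fun r r' hr hr' hrel => h 1 2 (by norm_num) r r' hr hr' ?_
  intro x hx
  simpa using hrel x hx

/-! ## §P The positive proof (general `n`, `m ≥ 1`) -/

/-- The diagonal continuous linear map `v ↦ (cᵢ vᵢ)ᵢ`. [folklore] -/
def diagCLM {n : ℕ} (c : Fin n → ℝ) : (Fin n → ℝ) →L[ℝ] (Fin n → ℝ) :=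
  ContinuousLinearMap.pi fun i => c i • (ContinuousLinearMap.proj i : (Fin n → ℝ) →L[ℝ] ℝ)

@[simp] theorem diagCLM_apply {n : ℕ} (c v : Fin n → ℝ) (i : Fin n) : diagCLM c v i = c i * v i := by
  simp [diagCLM]

/-- `det diag(c) = ∏ cᵢ`. [folklore] -/
theorem det_diagCLM {n : ℕ} (c : Fin n → ℝ) : (diagCLM c).det = ∏ i, c i := by
  have h : ((diagCLM c : (Fin n → ℝ) →L[ℝ] (Fin n → ℝ)) : (Fin n → ℝ) →ₗ[ℝ] (Fin n → ℝ)) =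
      Matrix.toLin' (Matrix.diagonal c) := by
    apply LinearMap.ext
    intro v
    funext i
    simp [diagCLM, Matrix.mulVec_diagonal]
  rw [ContinuousLinearMap.det, h, LinearMap.det_toLin', Matrix.det_diagonal]

/-- The power map `x ↦ (xᵢ^m)ᵢ` has derivative `diag(m xᵢ^(m-1))`. [folklore] -/
theorem hasFDerivAt_powMap {n : ℕ} (m : ℕ) (x : Fin n → ℝ) :
    HasFDerivAt (fun (x : Fin n → ℝ) (i : Fin n) => x i ^ m)
      (diagCLM fun i => (m : ℝ) * x i ^ (m - 1)) x := by
  rw [diagCLM]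
  refine hasFDerivAt_pi.2 fun i => ?_
  have h := (hasFDerivAt_apply (𝕜 := ℝ) i x).pow m
  rw [nsmul_eq_mul] at h
  exact h

/-- `x ↦ (xᵢ^m)ᵢ` maps the open unit box onto itself for `m ≥ 1`. [folklore] -/
theorem image_powMap_box {n m : ℕ} (hm : 1 ≤ m) :
    (fun (x : Fin n → ℝ) (i : Fin n) => x i ^ m) '' {x | ∀ i, x i ∈ Ioo (0 : ℝ) 1} =
      {x | ∀ i, x i ∈ Ioo (0 : ℝ) 1} := by
  have hm0 : m ≠ 0 := by omega
  ext y
  constructor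
  · rintro ⟨x, hx, rfl⟩ i
    exact ⟨pow_pos (hx i).1 m, pow_lt_one₀ (hx i).1.le (hx i).2 hm0⟩
  · intro hy
    refine ⟨fun i => y i ^ ((m : ℝ)⁻¹), fun i => ⟨?_, ?_⟩, ?_⟩
    · exact Real.rpow_pos_of_pos (hy i).1 _
    · exact Real.rpow_lt_one (hy i).1.le (hy i).2 (by positivity)
    · funext i
      exact Real.rpow_inv_natCast_pow (hy i).1.le hm0

/-- `x ↦ (xᵢ^m)ᵢ` is injective on the open unit box for `m ≥ 1`. [folklore] -/
theorem injOn_powMap_box {n m : ℕ} (hm : 1 ≤ m) :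
    InjOn (fun (x : Fin n → ℝ) (i : Fin n) => x i ^ m) {x | ∀ i, x i ∈ Ioo (0 : ℝ) 1} := by
  have hm0 : m ≠ 0 := by omega
  intro x hx y hy hxy
  funext i
  have h := congr_fun hxy i
  exact (pow_left_inj₀ (hx i).1.le (hy i).1.le hm0).1 h

/-- **§P. The crux HOLDS** (sorry-free; this is why no kill exists). Witness `Φ x = (xᵢ^m)ᵢ`,
`Φ' x = diag(m·xᵢ^(m-1))`: polynomial ⇒ `ℚ`-semialgebraic (`isSemialgebraicMapOn_aeval`), `HasFDerivAt`
everywhere, injective on the box with image the box (`m ≥ 1`), `|det| = mⁿ∏xᵢ^(m-1) > 0`.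
NOT landed by this (refuter) seat — provers copy it verbatim. [folklore] -/
theorem dilationMove_holds : DilationMove := by
  intro n m hm r r' hr hr' hint
  refine ⟨n, r, r', fun x i => x i ^ m, fun x => diagCLM fun i => (m : ℝ) * x i ^ (m - 1),
    ?_, ?_, ?_, ?_, ?_, rfl⟩
  · exact (isSemialgebraicMapOn_aeval r.isSemialgebraic_domain (fun i => X i ^ m)).congr
      (fun x _ => by funext j; simp)
  · intro x _
    exact (hasFDerivAt_powMap m x).hasFDerivWithinAt
  · rw [hr]
    exact injOn_powMap_box hm
  · rw [hr, hr', image_powMap_box hm]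
  · intro x hx
    rw [hint x hx, det_diagCLM, Finset.prod_mul_distrib, Finset.prod_const, Finset.card_univ,
      Fintype.card_fin, abs_of_pos]
    rw [hr] at hx
    exact mul_pos (pow_pos (by exact_mod_cast hm) n) (Finset.prod_pos fun i _ => pow_pos (hx i).1 _)



/-! ## §C A variant that is NOT refutable: the closed box (openness is not load-bearing) -/

/-- The crux on the CLOSED unit box `[0,1]ⁿ` (both domains), everything else verbatim. -/
def DilationMoveClosed : Prop :=
  ∀ (n m : ℕ), 1 ≤ m → ∀ (r r' : KZ.IntegralRep n), r.domain = {x | ∀ i, x i ∈ Icc (0 : ℝ) 1} →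
    r'.domain = {x | ∀ i, x i ∈ Icc (0 : ℝ) 1} →
    (∀ x ∈ r.domain, r.integrand x =
      r'.integrand (fun i => x i ^ m) * ((m : ℝ) ^ n * ∏ i, x i ^ (m - 1))) →
    KZ.of r - KZ.of r' ∈ KZ.changeOfVariablesRel

/-- `x ↦ (xᵢ^m)ᵢ` maps the closed unit box onto itself for `m ≥ 1`. [folklore] -/
theorem image_powMap_closedBox {n m : ℕ} (hm : 1 ≤ m) :
    (fun (x : Fin n → ℝ) (i : Fin n) => x i ^ m) '' {x | ∀ i, x i ∈ Icc (0 : ℝ) 1} =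
      {x | ∀ i, x i ∈ Icc (0 : ℝ) 1} := by
  have hm0 : m ≠ 0 := by omega
  ext y
  constructor
  · rintro ⟨x, hx, rfl⟩ i
    exact ⟨pow_nonneg (hx i).1 m, pow_le_one₀ (hx i).1 (hx i).2⟩
  · intro hy
    refine ⟨fun i => y i ^ ((m : ℝ)⁻¹), fun i => ⟨?_, ?_⟩, ?_⟩
    · exact Real.rpow_nonneg (hy i).1 _
    · exact Real.rpow_le_one (hy i).1 (hy i).2 (by positivity)
    · funext i
      exact Real.rpow_inv_natCast_pow (hy i).1 hm0

/-- `x ↦ (xᵢ^m)ᵢ` is injective on the closed unit box for `m ≥ 1`. [folklore] -/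
theorem injOn_powMap_closedBox {n m : ℕ} (hm : 1 ≤ m) :
    InjOn (fun (x : Fin n → ℝ) (i : Fin n) => x i ^ m) {x | ∀ i, x i ∈ Icc (0 : ℝ) 1} := by
  have hm0 : m ≠ 0 := by omega
  intro x hx y hy hxy
  funext i
  have h := congr_fun hxy i
  exact (pow_left_inj₀ (hx i).1 (hy i).1 hm0).1 h

/-- **The closed-box variant also HOLDS**: openness of the box is not used by the mechanism (only
`0 ≤ xᵢ` for injectivity / `|det| = det`, and the fixed points `0, 1` of `t ↦ t^m` for the image);
so "open vs closed box" is not an attack surface. Positive, not landed by this seat. [folklore] -/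
theorem dilationMoveClosed_holds : DilationMoveClosed := by
  intro n m hm r r' hr hr' hint
  refine ⟨n, r, r', fun x i => x i ^ m, fun x => diagCLM fun i => (m : ℝ) * x i ^ (m - 1),
    ?_, ?_, ?_, ?_, ?_, rfl⟩
  · exact (isSemialgebraicMapOn_aeval r.isSemialgebraic_domain (fun i => X i ^ m)).congr
      (fun x _ => by funext j; simp)
  · intro x _
    exact (hasFDerivAt_powMap m x).hasFDerivWithinAt
  · rw [hr]
    exact injOn_powMap_closedBox hm
  · rw [hr, hr', image_powMap_closedBox hm]
  · intro x hx
    rw [hint x hx, det_diagCLM, Finset.prod_mul_distrib, Finset.prod_const, Finset.card_univ,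
      Fintype.card_fin, abs_of_nonneg]
    rw [hr] at hx
    exact mul_nonneg (pow_nonneg (by positivity) n) (Finset.prod_nonneg fun i _ => pow_nonneg (hx i).1 _)

/-! ## §C′ The distinct-exponent variant also HOLDS (exponent uniformity is not load-bearing) -/

/-- The crux with a separate exponent `mᵢ ≥ 1` per coordinate, `Φ x = (xᵢ^(mᵢ))ᵢ`, Jacobian factor
`∏ᵢ mᵢ·xᵢ^(mᵢ-1)`; everything else verbatim. -/
def DilationMoveMulti : Prop :=
  ∀ (n : ℕ) (m : Fin n → ℕ), (∀ i, 1 ≤ m i) → ∀ (r r' : KZ.IntegralRep n),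
    r.domain = {x | ∀ i, x i ∈ Ioo (0 : ℝ) 1} → r'.domain = {x | ∀ i, x i ∈ Ioo (0 : ℝ) 1} →
    (∀ x ∈ r.domain, r.integrand x =
      r'.integrand (fun i => x i ^ m i) * ∏ i, ((m i : ℝ) * x i ^ (m i - 1))) →
    KZ.of r - KZ.of r' ∈ KZ.changeOfVariablesRel

/-- The multi-power map `x ↦ (xᵢ^(mᵢ))ᵢ` has derivative `diag(mᵢ xᵢ^(mᵢ-1))`. [folklore] -/
theorem hasFDerivAt_multiPowMap {n : ℕ} (m : Fin n → ℕ) (x : Fin n → ℝ) :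
    HasFDerivAt (fun (x : Fin n → ℝ) (i : Fin n) => x i ^ m i)
      (diagCLM fun i => (m i : ℝ) * x i ^ (m i - 1)) x := by
  rw [diagCLM]
  refine hasFDerivAt_pi.2 fun i => ?_
  have h := (hasFDerivAt_apply (𝕜 := ℝ) i x).pow (m i)
  rw [nsmul_eq_mul] at h
  exact h

/-- `x ↦ (xᵢ^(mᵢ))ᵢ` maps the open unit box onto itself when every `mᵢ ≥ 1`. [folklore] -/
theorem image_multiPowMap_box {n : ℕ} {m : Fin n → ℕ} (hm : ∀ i, 1 ≤ m i) :
    (fun (x : Fin n → ℝ) (i : Fin n) => x i ^ m i) '' {x | ∀ i, x i ∈ Ioo (0 : ℝ) 1} =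
      {x | ∀ i, x i ∈ Ioo (0 : ℝ) 1} := by
  have hm0 : ∀ i, m i ≠ 0 := fun i => by have := hm i; omega
  ext y
  constructor
  · rintro ⟨x, hx, rfl⟩ i
    exact ⟨pow_pos (hx i).1 (m i), pow_lt_one₀ (hx i).1.le (hx i).2 (hm0 i)⟩
  · intro hy
    refine ⟨fun i => y i ^ ((m i : ℝ)⁻¹), fun i => ⟨?_, ?_⟩, ?_⟩
    · exact Real.rpow_pos_of_pos (hy i).1 _
    · exact Real.rpow_lt_one (hy i).1.le (hy i).2 (inv_pos.2 (Nat.cast_pos.2 (hm i)))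
    · funext i
      exact Real.rpow_inv_natCast_pow (hy i).1.le (hm0 i)

/-- `x ↦ (xᵢ^(mᵢ))ᵢ` is injective on the open unit box when every `mᵢ ≥ 1`. [folklore] -/
theorem injOn_multiPowMap_box {n : ℕ} {m : Fin n → ℕ} (hm : ∀ i, 1 ≤ m i) :
    InjOn (fun (x : Fin n → ℝ) (i : Fin n) => x i ^ m i) {x | ∀ i, x i ∈ Ioo (0 : ℝ) 1} := by
  intro x hx y hy hxy
  funext i
  have h := congr_fun hxy i
  have hm0 : m i ≠ 0 := by have := hm i; omega
  exact (pow_left_inj₀ (hx i).1.le (hy i).1.le hm0).1 h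

/-- **The distinct-exponent variant HOLDS** (same witness shape; positive, not landed by this seat):
uniformity of the exponent across coordinates is not an attack surface. [folklore] -/
theorem dilationMoveMulti_holds : DilationMoveMulti := by
  intro n m hm r r' hr hr' hint
  refine ⟨n, r, r', fun x i => x i ^ m i, fun x => diagCLM fun i => (m i : ℝ) * x i ^ (m i - 1),
    ?_, ?_, ?_, ?_, ?_, rfl⟩
  · exact (isSemialgebraicMapOn_aeval r.isSemialgebraic_domain (fun i => X i ^ m i)).congr
      (fun x _ => by funext j; simp)
  · intro x _
    exact (hasFDerivAt_multiPowMap m x).hasFDerivWithinAt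
  · rw [hr]
    exact injOn_multiPowMap_box hm
  · rw [hr, hr', image_multiPowMap_box hm]
  · intro x hx
    rw [hint x hx, det_diagCLM, abs_of_pos]
    rw [hr] at hx
    exact Finset.prod_pos fun i _ => mul_pos (by exact_mod_cast hm i) (pow_pos (hx i).1 _)

/-- The crux is the uniform-exponent case of `DilationMoveMulti` (factor `∏ m·xᵢ^(m-1) = mⁿ·∏ xᵢ^(m-1)`).
[folklore] -/
theorem dilationMove_of_multi (h : DilationMoveMulti) : DilationMove := by
  intro n m hm r r' hr hr' hint
  refine h n (fun _ => m) (fun _ => hm) r r' hr hr' fun x hx => ?_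
  rw [hint x hx, Finset.prod_mul_distrib, Finset.prod_const, Finset.card_univ, Fintype.card_fin]

/-! ## §B Tightness: the Jacobian monomial is unique (dimension 1) -/

/-- **Necessity of `(c, k) = (m, m − 1)`.** If the dimension-1 move with factor `c·t^k` is valid
then `c = k + 1` (test integrand `r' = 1`: values `c/(k+1)` vs `1`) and then `k = m − 1`
(test integrand `r' = t`: values `c/(m+k+1)` vs `1/2`). [folklore] -/
theorem dilationMoveJac_one_necessary {m : ℕ} (hm : 1 ≤ m) {c : ℚ} {k : ℕ}
    (h : DilationMoveJac 1 m c k) : c = m ∧ k = m - 1 := by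
  -- test 1: r' = 1, r = c t^k
  have h1 : (monoRep 0 1 c k).value = (monoRep 0 1 1 0).value := by
    by_contra hne
    exact not_jac_of_witness c k 1 0 (fun x _ => by simp) hne h
  rw [value_monoRep_unit, value_monoRep_unit] at h1
  have hc : (c : ℝ) = k + 1 := by
    have hk : (k : ℝ) + 1 ≠ 0 := by positivity
    field_simp at h1
    push_cast at h1 ⊢
    linarith
  -- test 2: r' = t, r = c t^(m+k)
  have h2 : (monoRep 0 1 c (m + k)).value = (monoRep 0 1 1 1).value := by
    by_contra hne
    exact not_jac_of_witness c (m + k) 1 1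
      (fun x _ => by simp only [Fin.prod_univ_one, Rat.cast_one, one_mul, pow_one]; ring) hne h
  rw [value_monoRep_unit, value_monoRep_unit] at h2
  push_cast at h2
  rw [hc] at h2
  have hmk : (m : ℝ) + k + 1 ≠ 0 := by positivity
  have hkm : (k : ℝ) = m - 1 := by
    field_simp at h2
    linarith
  have hk' : k = m - 1 := by
    have : (k : ℝ) = ((m - 1 : ℕ) : ℝ) := by rw [hkm, Nat.cast_sub hm, Nat.cast_one]
    exact_mod_cast this
  refine ⟨?_, hk'⟩
  have : (c : ℝ) = (m : ℝ) := by
    rw [hc, hk', Nat.cast_sub hm, Nat.cast_one]; ring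
  exact_mod_cast this


/-- **TIGHTNESS (dimension 1).** The move with Jacobian factor `c·t^k` is valid iff
`(c, k) = (m, m − 1)`: the crux's Jacobian is the unique monomial that works. [folklore] -/
theorem dilationMoveJac_one_iff {m : ℕ} (hm : 1 ≤ m) (c : ℚ) (k : ℕ) :
    DilationMoveJac 1 m c k ↔ c = m ∧ k = m - 1 := by
  refine ⟨dilationMoveJac_one_necessary hm, ?_⟩
  rintro ⟨rfl, rfl⟩
  have h := dilationMove_iff_jac.1 dilationMove_holds 1 m hm
  rwa [pow_one] at h


/-! ## §D Tightness in ALL dimensions (cycle 2): the constant `mⁿ` is dimension-dependent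

The consumers of the crux (ReductionTwoSix: `(n,m) = (2,2), (2,3)`; AperySectorThreeTwo:
`(n,m) = (3,2)`) specialise `n`. The natural slip is to carry the one-dimensional constant `m`
(or no constant) into dimension `n`. §D shows the Jacobian factor `c·∏ᵢ xᵢ^k` is valid on the
unit box `(0,1)ⁿ`, `n ≥ 1`, IFF `c = mⁿ` and `k + 1 = m` — for EVERY `m : ℕ` (so `m = 0` is dead in
every dimension for every factor, sharpening §A). Test integrands: `r' = 1` and `r' = ∏ᵢ xᵢ`
against product-monomial sources; values by Fubini on the box (`value_prodRep`). Dimension `0` is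
the junk case: the move holds iff `c = 1` whatever `m, k` (`dilationMoveJac_zero_iff`). -/

/-- The product-monomial representation `[(0,1)ⁿ, x ↦ c·∏ᵢ xᵢ^k]` (`c ∈ ℚ`). [folklore] -/
def prodRep (n : ℕ) (c : ℚ) (k : ℕ) : KZ.IntegralRep n where
  domain := {x | ∀ i, x i ∈ Ioo (0 : ℝ) 1}
  integrand := fun x => (c : ℝ) * ∏ i, x i ^ k
  isSemialgebraic_domain := by
    rw [← ibox_zero_one]
    exact isSemialgebraic_ibox n 0 1
  isSemialgebraicFunOn_integrand := by
    rw [← ibox_zero_one]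
    exact (isSemialgebraicFunOn_aeval (isSemialgebraic_ibox n 0 1) (C c * ∏ i, X i ^ k)).congr
      (fun x _ => by simp [map_prod])
  integrableOn := by
    have hc : Continuous fun x : Fin n → ℝ => (c : ℝ) * ∏ i, x i ^ k := by fun_prop
    refine (hc.continuousOn.integrableOn_compact
      (isCompact_Icc : IsCompact (Icc (0 : Fin n → ℝ) 1))).mono_set ?_
    intro x hx
    exact ⟨fun i => (hx i).1.le, fun i => (hx i).2.le⟩

/-- Auxiliary: `prodRep_domain`. [folklore] -/
@[simp] theorem prodRep_domain (n : ℕ) (c : ℚ) (k : ℕ) :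
    (prodRep n c k).domain = {x | ∀ i, x i ∈ Ioo (0 : ℝ) 1} := rfl

/-- Auxiliary: `prodRep_integrand`. [folklore] -/
@[simp] theorem prodRep_integrand (n : ℕ) (c : ℚ) (k : ℕ) :
    (prodRep n c k).integrand = fun x => (c : ℝ) * ∏ i, x i ^ k := rfl

/-- The unit box is the product set `univ.pi (fun _ => (0,1))`. [folklore] -/
theorem ubox_eq_pi (n : ℕ) :
    {x : Fin n → ℝ | ∀ i, x i ∈ Ioo (0 : ℝ) 1} = Set.univ.pi fun _ : Fin n => Ioo (0 : ℝ) 1 := by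
  ext x
  simp

/-- `∫_(0,1) t^k dt = 1/(k+1)`. [folklore] -/
theorem setIntegral_pow_Ioo (k : ℕ) : ∫ t in Ioo (0 : ℝ) 1, t ^ k = 1 / ((k : ℝ) + 1) := by
  rw [← integral_Ioc_eq_integral_Ioo, ← intervalIntegral.integral_of_le zero_le_one, integral_pow]
  simp

/-- **Value of the product-monomial rep** (Fubini on the box): `c / (k+1)ⁿ`. [folklore] -/
theorem value_prodRep (n : ℕ) (c : ℚ) (k : ℕ) :
    (prodRep n c k).value = c / ((k : ℝ) + 1) ^ n := by
  rw [KZ.IntegralRep.value, prodRep_domain, ubox_eq_pi, volume_pi, Measure.restrict_pi_pi]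
  simp only [prodRep_integrand]
  rw [MeasureTheory.integral_const_mul, integral_fintype_prod_eq_pow (fun t : ℝ => t ^ k),
    setIntegral_pow_Ioo, Fintype.card_fin]
  rw [one_div, inv_pow, div_eq_mul_inv]

/-- Master lemma for family 2 in dimension `n`: a pair of product-monomial witnesses with different
values kills `DilationMoveJac n m c₀ k₀`. [folklore] -/
theorem not_jacN_of_witness {n m : ℕ} {c₀ : ℚ} {k₀ : ℕ} (c : ℚ) (k : ℕ) (c' : ℚ) (k' : ℕ)
    (hrel : ∀ x : Fin n → ℝ, (∀ i, x i ∈ Ioo (0 : ℝ) 1) →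
      (c : ℝ) * ∏ i, x i ^ k = (c' : ℝ) * (∏ i, (x i ^ m) ^ k') * ((c₀ : ℝ) * ∏ i, x i ^ k₀))
    (hne : (prodRep n c k).value ≠ (prodRep n c' k').value) :
    ¬ DilationMoveJac n m c₀ k₀ := by
  intro h
  exact hne (value_eq_of_mem (h (prodRep n c k) (prodRep n c' k') rfl rfl fun x hx => hrel x hx))

/-- **Necessity in dimension `n ≥ 1`, for every `m : ℕ`.** If the move with factor `c·∏ xᵢ^k` is
valid then `c = (k+1)ⁿ` (test `r' = 1`) and `2(k+1) = m+k+1` (test `r' = ∏ xᵢ`, then injectivity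
of `t ↦ tⁿ` on `(0,∞)`), i.e. `k + 1 = m` and `c = mⁿ`. In particular NO factor works at `m = 0`.
[folklore] -/
theorem dilationMoveJac_necessary {n m : ℕ} (hn : 1 ≤ n) {c : ℚ} {k : ℕ}
    (h : DilationMoveJac n m c k) : c = (m : ℚ) ^ n ∧ k + 1 = m := by
  have hn0 : n ≠ 0 := by omega
  -- test 1: r' = 1, r = c·∏ xᵢ^k
  have h1 : (prodRep n c k).value = (prodRep n 1 0).value := by
    by_contra hne
    exact not_jacN_of_witness c k 1 0 (fun x _ => by simp) hne h
  rw [value_prodRep, value_prodRep] at h1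
  have hk0 : ((k : ℝ) + 1) ^ n ≠ 0 := by positivity
  have hc : (c : ℝ) = ((k : ℝ) + 1) ^ n := by
    rw [div_eq_iff hk0] at h1
    rw [h1]
    simp
  -- test 2: r' = ∏ xᵢ, r = c·∏ xᵢ^(m+k)
  have h2 : (prodRep n c (m + k)).value = (prodRep n 1 1).value := by
    by_contra hne
    refine not_jacN_of_witness c (m + k) 1 1 (fun x _ => ?_) hne h
    simp only [pow_add, Finset.prod_mul_distrib, pow_one, Rat.cast_one, one_mul]
    ring
  rw [value_prodRep, value_prodRep, hc] at h2
  push_cast at h2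
  have hmk : (((m : ℝ) + k) + 1) ^ n ≠ 0 := by positivity
  have h3 : ((2 : ℝ) * ((k : ℝ) + 1)) ^ n = (((m : ℝ) + k) + 1) ^ n := by
    rw [div_eq_div_iff hmk (by positivity)] at h2
    rw [mul_pow]
    linear_combination h2
  have h4 : (2 : ℝ) * ((k : ℝ) + 1) = ((m : ℝ) + k) + 1 :=
    (pow_left_inj₀ (by positivity) (by positivity) hn0).1 h3
  have hkm : k + 1 = m := by
    have : ((k + 1 : ℕ) : ℝ) = (m : ℝ) := by
      push_cast
      linarith
    exact_mod_cast this
  refine ⟨?_, hkm⟩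
  have : (c : ℝ) = (((m : ℚ) ^ n : ℚ) : ℝ) := by
    rw [hc, ← hkm]
    push_cast
    ring
  exact_mod_cast this

/-- **TIGHTNESS IN ALL DIMENSIONS.** For `n ≥ 1` and any `m : ℕ`, the dilation move on `(0,1)ⁿ`
with Jacobian factor `c·∏ᵢ xᵢ^k` (`c ∈ ℚ`, `k ∈ ℕ`) is valid iff `c = mⁿ` and `k + 1 = m`: the
crux's `mⁿ·∏ xᵢ^(m-1)` is the unique monomial factor, and its constant depends on the dimension.
[folklore] -/
theorem dilationMoveJac_iff {n m : ℕ} (hn : 1 ≤ n) (c : ℚ) (k : ℕ) :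
    DilationMoveJac n m c k ↔ c = (m : ℚ) ^ n ∧ k + 1 = m := by
  refine ⟨dilationMoveJac_necessary hn, ?_⟩
  rintro ⟨rfl, hkm⟩
  have hm : 1 ≤ m := by omega
  have h := dilationMove_iff_jac.1 dilationMove_holds n m hm
  rwa [show m - 1 = k by omega] at h

/-- **`m = 0` is dead in every dimension `n ≥ 1`, for every factor** (no Jacobian repair rescues
the constant map; sharpens `dilationMove_false_without_oneLe`). [folklore] -/
theorem not_dilationMoveJac_zero_exp {n : ℕ} (hn : 1 ≤ n) (c : ℚ) (k : ℕ) :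
    ¬ DilationMoveJac n 0 c k := fun h =>
  absurd (dilationMoveJac_necessary hn h).2 (by omega)

/-- **The one-dimensional constant does not survive in dimension 2**: `(n,m) = (2,2)` with factor
`2·xy` (instead of `4·xy`) is NOT a move — `r' = 1`, `r = 2xy` have values `1 ≠ 1/2`. This is the
slip to avoid when ReductionTwoSix writes `H_r + H_(r+3) ∼ 4·H_(2r+1)` (the `4` is `2²`).
[folklore] -/
theorem not_dilationMoveJac_two_two_linear : ¬ DilationMoveJac 2 2 2 1 := fun h => by
  have := (dilationMoveJac_necessary (by norm_num) h).1
  norm_num at this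

/-- **No constant at all fails for every `m ≥ 2`, `n ≥ 1`** (factor `∏ xᵢ^(m-1)` alone).
[folklore] -/
theorem not_dilationMoveJac_noConstant {n m : ℕ} (hn : 1 ≤ n) (hm : 2 ≤ m) :
    ¬ DilationMoveJac n m 1 (m - 1) := fun h => by
  have h1 := (dilationMoveJac_necessary hn h).1
  have h2 : (1 : ℚ) < (m : ℚ) ^ n := one_lt_pow₀ (by exact_mod_cast hm) (by omega)
  exact absurd h1 (ne_of_lt h2)

/-- The consumer instance `(n,m) = (2,2)` (ReductionTwoSix, level 3 → 6; CatalanSectorTwoFour,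
level 2 → 4): valid iff the factor is `4·xy`. [folklore] -/
theorem dilationMoveJac_two_two_iff (c : ℚ) (k : ℕ) : DilationMoveJac 2 2 c k ↔ c = 4 ∧ k = 1 := by
  rw [dilationMoveJac_iff (by norm_num)]
  norm_num
  omega

/-- The consumer instance `(n,m) = (2,3)` (ReductionTwoSix, level 2 → 6): valid iff the factor is
`9·x²y²`. [folklore] -/
theorem dilationMoveJac_two_three_iff (c : ℚ) (k : ℕ) : DilationMoveJac 2 3 c k ↔ c = 9 ∧ k = 2 := by
  rw [dilationMoveJac_iff (by norm_num)]
  norm_num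
  omega

/-- The consumer instance `(n,m) = (3,2)` (AperySectorThreeTwo, `H₀ + H₁ ∼ 8H₁`): valid iff the
factor is `8·xyz`. [folklore] -/
theorem dilationMoveJac_three_two_iff (c : ℚ) (k : ℕ) : DilationMoveJac 3 2 c k ↔ c = 8 ∧ k = 1 := by
  rw [dilationMoveJac_iff (by norm_num)]
  norm_num
  omega

/-- **Degenerate dimension `n = 0`** (`Fin 0 → ℝ` is one point of volume 1, value = integrand at
the point, `x ↦ x^m` is the identity): the move with factor `c` holds iff `c = 1`, whatever `m, k`.
So `1 ≤ n` in `dilationMoveJac_iff` is needed, and at `n = 0` even `m = 0` is harmless. [folklore] -/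
theorem dilationMoveJac_zero_iff (m : ℕ) (c : ℚ) (k : ℕ) : DilationMoveJac 0 m c k ↔ c = 1 := by
  constructor
  · intro h
    have h1 : (prodRep 0 c k).value = (prodRep 0 1 0).value := by
      by_contra hne
      exact not_jacN_of_witness c k 1 0 (fun x _ => by simp) hne h
    rw [value_prodRep, value_prodRep] at h1
    norm_num at h1
    exact_mod_cast h1
  · rintro rfl
    intro r r' hr hr' hrel
    refine dilationMove_iff_jac.1 dilationMove_holds 0 1 le_rfl r r' hr hr' fun x hx => ?_
    rw [hrel x hx]
    have hx' : (fun i => x i ^ m) = fun i => x i ^ 1 := funext fun i => Fin.elim0 i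
    simp [hx']


/-! ## §E (cycle 3) Targets: the PICKED line `coordpow-api-assembly` and its stubs

The lead picked `Lines/coordpow-api-assembly.lean` (PICKED.md, 2026-08-16): two registered stubs
`stub_isSemialgebraicMapOn_coordPow` (tameness of `Φₘ = BoxIntegral.coordPow m` on any `ℚ`-semialgebraic
set) and `stub_orthantCoordPowMove` (the move on ANY domain inside the open orthant, target
`Φₘ '' r.domain`), composed to the crux via `BoxIntegral.image_coordPow_box`. Attack result: **both stubs
are TRUE** (`stub_isSemialgebraicMapOn_coordPow_holds`, `stub_orthantCoordPowMove_holds` below, sorry-free,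
verbatim signatures) — no target is breakable. What §E adds for the lead is the load-bearing analysis of
stub 2: its orthant hypothesis is necessary EXACTLY for even `m` (`CoordPowMoveAnyDomain`,
`not_coordPowMoveAnyDomain_one_even`: on `(-1,1)` with the HONEST image `[0,1)` the signed Jacobian of the
2-to-1 map cancels the sheets, values `0 ≠ 1`; `coordPowMoveAnyDomain_of_odd`: for odd `m` the stub holds
on every domain; `coordPowMoveAnyDomain_one_iff_odd`), and the closed orthant `{0 ≤ xᵢ}` already suffices
(`coordPowMove_of_subset_closedOrthant`). Filed for landing as `Theorems/DilationMove/Negative/StubOrthant.lean`. -/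

/-- **Target 1 HOLDS** (verbatim registered signature of `stub_isSemialgebraicMapOn_coordPow`): the
polynomial map `(Xᵢ^m)ᵢ` is `ℚ`-semialgebraic on every `ℚ`-semialgebraic set. Positive — the lead lands
it, not this seat. [BCR 1998, §2.2] -/
theorem stub_isSemialgebraicMapOn_coordPow_holds :
    ∀ (n m : ℕ) (σ : Set (Fin n → ℝ)), IsSemialgebraic ℚ σ →
      IsSemialgebraicMapOn ℚ σ (fun x : Fin n → ℝ => BoxIntegral.coordPow m x) :=
  fun _ m _ hσ => (isSemialgebraicMapOn_aeval hσ (fun i => X i ^ m)).congr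
    (fun x _ => by funext j; simp)

/-- **Target 2 HOLDS** (verbatim registered signature of `stub_orthantCoordPowMove`): witness
`Φ' = BoxIntegral.coordPowDeriv m`, injectivity from `BoxIntegral.injOn_coordPow` (closed orthant),
`|det| = det = mⁿ ∏ xᵢ^(m-1) > 0` on the open orthant. Positive — the lead lands it. [Kontsevich–Zagier 2001, §1.2 (2)] -/
theorem stub_orthantCoordPowMove_holds :
    ∀ (n m : ℕ), 1 ≤ m → ∀ (r r' : KZ.IntegralRep n), r.domain ⊆ {x | ∀ i, 0 < x i} →
      IsSemialgebraicMapOn ℚ r.domain (fun x : Fin n → ℝ => BoxIntegral.coordPow m x) →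
      r'.domain = (fun x : Fin n → ℝ => BoxIntegral.coordPow m x) '' r.domain →
      (∀ x ∈ r.domain, r.integrand x =
        r'.integrand (BoxIntegral.coordPow m x) * ((m : ℝ) ^ n * ∏ i, x i ^ (m - 1))) →
      KZ.of r - KZ.of r' ∈ KZ.changeOfVariablesRel := by
  intro n m hm r r' hsub hΦ hdom hrel
  have hm0 : m ≠ 0 := by omega
  refine ⟨n, r, r', fun x => BoxIntegral.coordPow m x, fun x => BoxIntegral.coordPowDeriv m x, hΦ,
    fun x _ => BoxIntegral.hasFDerivWithinAt_coordPow m _ x,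
    (BoxIntegral.injOn_coordPow hm0).mono fun x hx i => (hsub hx i).le, hdom, ?_, rfl⟩
  intro x hx
  rw [hrel x hx, BoxIntegral.det_coordPowDeriv, abs_of_pos]
  exact mul_pos (pow_pos (by exact_mod_cast Nat.pos_of_ne_zero hm0) n)
    (Finset.prod_pos fun i _ => pow_pos (hsub hx i) _)

/-- The two targets compose to the crux exactly as in the skeleton's `DilationMove_of` (so the picked
line closes; recorded here so that the `-- Targets` verdict is kernel-checked end to end). [folklore] -/
theorem dilationMove_of_targets : DilationMove := by
  intro n m hm r r' hr hr' hint
  have hm0 : m ≠ 0 := by omega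
  have hsub : r.domain ⊆ {x | ∀ i, 0 < x i} := by
    rw [hr]
    exact fun x hx i => (hx i).1
  refine stub_orthantCoordPowMove_holds n m hm r r' hsub
    (stub_isSemialgebraicMapOn_coordPow_holds n m r.domain r.isSemialgebraic_domain) ?_ ?_
  · rw [hr', hr]
    exact (BoxIntegral.image_coordPow_box hm0).symm
  · intro x hx
    exact hint x hx

/-! ### §E.2 Load-bearing analysis of target 2: the orthant is needed exactly for even `m` -/

/-- Target 2 at fixed `(n, m)` with the orthant hypothesis `r.domain ⊆ {x | ∀ i, 0 < x i}` DELETED,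
everything else verbatim (tameness, the HONEST image clause, the typed Jacobian factor). -/
def CoordPowMoveAnyDomain (n m : ℕ) : Prop :=
  ∀ (r r' : KZ.IntegralRep n),
    IsSemialgebraicMapOn ℚ r.domain (fun x : Fin n → ℝ => BoxIntegral.coordPow m x) →
    r'.domain = (fun x : Fin n → ℝ => BoxIntegral.coordPow m x) '' r.domain →
    (∀ x ∈ r.domain, r.integrand x =
      r'.integrand (BoxIntegral.coordPow m x) * ((m : ℝ) ^ n * ∏ i, x i ^ (m - 1))) →
    KZ.of r - KZ.of r' ∈ KZ.changeOfVariablesRel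

/-- Target 2 with the orthant hypothesis deleted, quantified as in the skeleton (all `n`, `m ≥ 1`). -/
def OrthantCoordPowMoveWithoutOrthant : Prop :=
  ∀ (n m : ℕ), 1 ≤ m → CoordPowMoveAnyDomain n m

/-- The half-open box `{x | ∀ i, x i ∈ [0,1)} ⊆ ℝⁿ` (the honest image of `(-1,1)ⁿ` under an even
power map). [folklore] -/
def icoBox (n : ℕ) : Set (Fin n → ℝ) := {x | ∀ i, x i ∈ Ico (0 : ℝ) 1}

/-- The half-open box is `ℚ`-semialgebraic. [folklore] -/
theorem isSemialgebraic_icoBox (n : ℕ) : IsSemialgebraic ℚ (icoBox n) := by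
  have h : ∀ i : Fin n, IsSemialgebraic ℚ {x : Fin n → ℝ | x i ∈ Ico (0 : ℝ) 1} := by
    intro i
    have h1 := (isSemialgebraic_setOf_eval_le (k := ℚ) (R := ℝ) (ι := Fin n) (C 0) (X i)).inter
      (isSemialgebraic_setOf_eval_lt (k := ℚ) (R := ℝ) (ι := Fin n) (X i) (C 1))
    have hEq : {x : Fin n → ℝ | x i ∈ Ico (0 : ℝ) 1} =
        {x : Fin n → ℝ | aeval x (C 0 : MvPolynomial (Fin n) ℚ) ≤ aeval x (X i : MvPolynomial (Fin n) ℚ)} ∩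
        {x : Fin n → ℝ | aeval x (X i : MvPolynomial (Fin n) ℚ) < aeval x (C 1 : MvPolynomial (Fin n) ℚ)} := by
      ext x
      simp
    rw [hEq]
    exact h1
  have hEq : icoBox n = ⋂ i ∈ (Finset.univ : Finset (Fin n)), {x : Fin n → ℝ | x i ∈ Ico (0 : ℝ) 1} := by
    ext x
    simp [icoBox]
  rw [hEq]
  exact IsSemialgebraic.biInter _ _ fun i _ => h i

/-- The half-open box is the product set `univ.pi (fun _ => [0,1))`. [folklore] -/
theorem icoBox_eq_pi (n : ℕ) : icoBox n = Set.univ.pi fun _ : Fin n => Ico (0 : ℝ) 1 := by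
  ext x
  simp [icoBox]

/-- The half-open box has volume `1`. [folklore] -/
theorem volume_icoBox (n : ℕ) : volume (icoBox n) = 1 := by
  rw [icoBox_eq_pi, volume_pi_pi]
  simp [Real.volume_Ico]

/-- The constant representation `[[0,1)ⁿ, 1]`. [folklore] -/
def icoRep (n : ℕ) : KZ.IntegralRep n where
  domain := icoBox n
  integrand := fun _ => 1
  isSemialgebraic_domain := isSemialgebraic_icoBox n
  isSemialgebraicFunOn_integrand :=
    (isSemialgebraicFunOn_aeval (isSemialgebraic_icoBox n) (C 1)).congr (fun x _ => by simp)
  integrableOn := by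
    refine integrableOn_const ?_
    rw [volume_icoBox]
    exact ENNReal.one_ne_top

/-- Auxiliary: `icoRep_domain`. [folklore] -/
@[simp] theorem icoRep_domain (n : ℕ) : (icoRep n).domain = icoBox n := rfl

/-- Auxiliary: `icoRep_integrand`. [folklore] -/
@[simp] theorem icoRep_integrand (n : ℕ) : (icoRep n).integrand = fun _ => 1 := rfl

/-- The value of `[[0,1)ⁿ, 1]` is `1`. [folklore] -/
theorem value_icoRep (n : ℕ) : (icoRep n).value = 1 := by
  rw [KZ.IntegralRep.value, icoRep_domain, icoRep_integrand, setIntegral_const]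
  simp [Measure.real, volume_icoBox]

/-- For even `m ≠ 0`, `Φₘ '' (-1,1) = [0,1)` exactly (dimension 1). [folklore] -/
theorem image_coordPow_symmBox_even {m : ℕ} (hm : Even m) (hm0 : m ≠ 0) :
    (fun x : Fin 1 → ℝ => BoxIntegral.coordPow m x) '' ibox 1 (-1) 1 = icoBox 1 := by
  ext y
  simp only [mem_image, ibox, icoBox, mem_setOf_eq, Rat.cast_neg, Rat.cast_one, mem_Ioo, mem_Ico]
  constructor
  · rintro ⟨x, hx, rfl⟩ i
    refine ⟨?_, ?_⟩
    · simpa using hm.pow_nonneg (x i)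
    · have habs : |x i| < 1 := abs_lt.2 ⟨(hx i).1, (hx i).2⟩
      have h := pow_lt_one₀ (abs_nonneg (x i)) habs hm0
      rw [hm.pow_abs] at h
      simpa using h
  · intro hy
    refine ⟨fun i => y i ^ ((m : ℝ)⁻¹), fun i => ⟨?_, ?_⟩, ?_⟩
    · exact lt_of_lt_of_le (by norm_num) (Real.rpow_nonneg (hy i).1 _)
    · exact Real.rpow_lt_one (hy i).1 (hy i).2 (by positivity)
    · funext i
      simp only [BoxIntegral.coordPow_apply]
      exact Real.rpow_inv_natCast_pow (hy i).1 hm0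

/-- The value of `[(-1,1), m·t^(m-1)]` vanishes for even `m ≠ 0` (odd integrand). [folklore] -/
theorem value_monoRep_symm_even {m : ℕ} (hm : Even m) (hm0 : m ≠ 0) :
    (monoRep (-1) 1 m (m - 1)).value = 0 := by
  rw [value_monoRep (-1) 1 m (m - 1) (by norm_num), integral_pow]
  have h1 : m - 1 + 1 = m := by omega
  rw [h1]
  push_cast
  rw [hm.neg_one_pow]
  simp

/-- **Even `m ≥ 2`: target 2 without the orthant is FALSE in dimension 1.** Witness
`r = [(-1,1), m·t^(m-1)]`, `r' = [[0,1), 1]`: `Φₘ` polynomial (tame), `Φₘ '' (-1,1) = [0,1)` the honest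
image, the typed integrand relation, values `0 ≠ 1` — the SIGNED Jacobian of the 2-to-1 map cancels
the two sheets (with `|m t^(m-1)|` one would get `2`, equally wrong). [folklore] -/
theorem not_coordPowMoveAnyDomain_one_even {m : ℕ} (hm : Even m) (hm0 : m ≠ 0) :
    ¬ CoordPowMoveAnyDomain 1 m := by
  intro h
  have hmem := h (monoRep (-1) 1 m (m - 1)) (icoRep 1)
    ((isSemialgebraicMapOn_aeval (isSemialgebraic_ibox 1 (-1) 1) (fun i => X i ^ m)).congr
      (fun x _ => by funext j; simp))
    (by rw [icoRep_domain, monoRep_domain, image_coordPow_symmBox_even hm hm0])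
    (fun x _ => by simp)
  have hv := value_eq_of_mem hmem
  rw [value_monoRep_symm_even hm hm0, value_icoRep] at hv
  exact zero_ne_one hv

/-- In particular `(n, m) = (1, 2)`: squaring on `(-1,1)` with factor `2t` and honest target `[0,1)`
is not a move. [folklore] -/
theorem not_coordPowMoveAnyDomain_one_two : ¬ CoordPowMoveAnyDomain 1 2 :=
  not_coordPowMoveAnyDomain_one_even even_two two_ne_zero

/-- **Any proof of target 2 must use the orthant hypothesis.** [folklore] -/
theorem orthantCoordPowMove_false_without_orthant : ¬ OrthantCoordPowMoveWithoutOrthant :=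
  fun h => not_coordPowMoveAnyDomain_one_two (h 1 2 (by norm_num))

/-- **Odd `m`: target 2 without the orthant HOLDS, in every dimension, on every domain** (`t ↦ t^m`
strictly monotone on `ℝ`; `det Φₘ' = mⁿ ∏ xᵢ^(m-1) ≥ 0` as `m − 1` is even). Positive, not a Theses
statement: it marks the exact extent of the negative result. [folklore] -/
theorem coordPowMoveAnyDomain_of_odd {n m : ℕ} (hm : Odd m) : CoordPowMoveAnyDomain n m := by
  intro r r' hΦ hdom hrel
  refine ⟨n, r, r', fun x => BoxIntegral.coordPow m x, fun x => BoxIntegral.coordPowDeriv m x, hΦ,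
    fun x _ => BoxIntegral.hasFDerivWithinAt_coordPow m _ x, ?_, hdom, ?_, rfl⟩
  · intro x _ y _ hxy
    funext i
    have h := congr_fun hxy i
    simp only [BoxIntegral.coordPow_apply] at h
    exact hm.strictMono_pow.injective h
  · intro x hx
    have he : Even (m - 1) := by
      obtain ⟨k, rfl⟩ := hm
      exact ⟨k, by omega⟩
    rw [hrel x hx, BoxIntegral.det_coordPowDeriv, abs_of_nonneg]
    exact mul_nonneg (by positivity) (Finset.prod_nonneg fun i _ => he.pow_nonneg _)

/-- **Dichotomy in dimension 1**: for `m ≥ 1`, target 2 without the orthant holds iff `m` is odd.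
[folklore] -/
theorem coordPowMoveAnyDomain_one_iff_odd {m : ℕ} (hm : 1 ≤ m) :
    CoordPowMoveAnyDomain 1 m ↔ Odd m := by
  refine ⟨fun h => ?_, coordPowMoveAnyDomain_of_odd⟩
  rcases Nat.even_or_odd m with he | ho
  · exact absurd h (not_coordPowMoveAnyDomain_one_even he (by omega))
  · exact ho

/-- **Openness of the orthant is not load-bearing**: target 2 holds verbatim with the CLOSED orthant
`{x | ∀ i, 0 ≤ xᵢ}` (`Φₘ` injective there, `det ≥ 0`), every `m ≥ 1`. [folklore] -/
theorem coordPowMove_of_subset_closedOrthant {n m : ℕ} (hm : 1 ≤ m) (r r' : KZ.IntegralRep n)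
    (hsub : r.domain ⊆ {x | ∀ i, 0 ≤ x i})
    (hΦ : IsSemialgebraicMapOn ℚ r.domain (fun x : Fin n → ℝ => BoxIntegral.coordPow m x))
    (hdom : r'.domain = (fun x : Fin n → ℝ => BoxIntegral.coordPow m x) '' r.domain)
    (hrel : ∀ x ∈ r.domain, r.integrand x =
      r'.integrand (BoxIntegral.coordPow m x) * ((m : ℝ) ^ n * ∏ i, x i ^ (m - 1))) :
    KZ.of r - KZ.of r' ∈ KZ.changeOfVariablesRel := by
  have hm0 : m ≠ 0 := by omega
  refine ⟨n, r, r', fun x => BoxIntegral.coordPow m x, fun x => BoxIntegral.coordPowDeriv m x, hΦ,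
    fun x _ => BoxIntegral.hasFDerivWithinAt_coordPow m _ x,
    (BoxIntegral.injOn_coordPow hm0).mono hsub, hdom, ?_, rfl⟩
  intro x hx
  rw [hrel x hx, BoxIntegral.det_coordPowDeriv, abs_of_nonneg]
  exact mul_nonneg (by positivity) (Finset.prod_nonneg fun i _ => pow_nonneg (hsub hx i) _)


/-! ## §F (cycle 3) Domain shape: "same source and target" needs a `Φₘ`-stable domain

The crux types the SAME domain `(0,1)ⁿ` for `r` and `r'`, which works because `Φₘ '' (0,1)ⁿ = (0,1)ⁿ`.
The route's foreseen "box → simplex/cone upgrade" and the sibling item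
`OctahedralSymmetry.SimplexDilationMove` (stmt-9436) carry the engine to simplices. Family 3
`DilationMoveOn n m D` (both domains `D`): POSITIVE for every `Φₘ`-stable `D` in the closed orthant
(`dilationMoveOn_of_image_eq`), e.g. the unit box (crux) and the ORDERED simplex
`{0 < tᵢ < 1, StrictAnti t}` (`dilationMoveOn_orderedSimplex`, all `m ≥ 1` — so stmt-9436 is true and a
candidate proof is attached THERE); NEGATIVE for the STANDARD simplex `{x, y > 0, x + y < 1}` already at
`(n, m) = (2, 2)` (`not_dilationMoveOn_stdSimplex_two_two`: `r' = [S, 1]`, `r = [S, 4xy]`, typed relation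
holds, but `∫_S 4xy < ∫_S 1` strictly since `4xy ≤ (x+y)² < 1` on `S`; root cause
`Φ₂ '' S = {√u + √v < 1} ⊊ S`, areas `1/6 ≠ 1/2`). Hence the image clause `r'.domain = Φₘ '' r.domain` of
the picked line's stub cannot be weakened to `r'.domain = r.domain` (`not_forall_dilationMoveOn_orthant`).
Filed for landing as `Theorems/DilationMove/Negative/DomainShape.lean`. -/

/-! ## Family 3: the domain varied, source = target -/

/-- FAMILY 3 (domain shape). The crux at fixed `(n, m)` with BOTH domains replaced by `D`
(everything else verbatim). [folklore] -/
def DilationMoveOn (n m : ℕ) (D : Set (Fin n → ℝ)) : Prop :=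
  ∀ (r r' : KZ.IntegralRep n), r.domain = D → r'.domain = D →
    (∀ x ∈ r.domain, r.integrand x =
      r'.integrand (fun i => x i ^ m) * ((m : ℝ) ^ n * ∏ i, x i ^ (m - 1))) →
    KZ.of r - KZ.of r' ∈ KZ.changeOfVariablesRel

/-- ANCHOR 3: the crux is the unit-box member of family 3, for all `n` and `m ≥ 1`. [folklore] -/
theorem dilationMove_iff_on :
    DilationMove ↔ ∀ n m : ℕ, 1 ≤ m → DilationMoveOn n m {x | ∀ i, x i ∈ Ioo (0 : ℝ) 1} :=
  Iff.rfl

/-- **Positive principle.** If `D` lies in the closed orthant and is `Φₘ`-stable (`Φₘ '' D = D`),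
the move with equal source and target `D` is ONE change of variables (`m ≥ 1`): `Φₘ` is polynomial
(tame on the semialgebraic `D = r.domain`), injective on the closed orthant, `det Φₘ' = mⁿ∏xᵢ^(m-1) ≥ 0`.
(Positive, not a Theses statement: it is the exact criterion the negative instance below violates.)
[Kontsevich–Zagier 2001, §1.2 (2)] -/
theorem dilationMoveOn_of_image_eq {n m : ℕ} (hm : 1 ≤ m) {D : Set (Fin n → ℝ)}
    (hD : D ⊆ {x | ∀ i, 0 ≤ x i})
    (himg : (fun x : Fin n → ℝ => fun i => x i ^ m) '' D = D) : DilationMoveOn n m D := by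
  intro r r' hr hr' hrel
  have hm0 : m ≠ 0 := by omega
  refine ⟨n, r, r', fun x i => x i ^ m, fun x => BoxIntegral.coordPowDeriv m x, ?_, ?_, ?_, ?_, ?_, rfl⟩
  · exact (isSemialgebraicMapOn_aeval r.isSemialgebraic_domain (fun i => X i ^ m)).congr
      (fun x _ => by funext j; simp)
  · intro x _
    exact BoxIntegral.hasFDerivWithinAt_coordPow m _ x
  · rw [hr]
    exact (BoxIntegral.injOn_coordPow hm0).mono hD
  · rw [hr, hr', himg]
  · intro x hx
    rw [hrel x hx, BoxIntegral.det_coordPowDeriv, abs_of_nonneg]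
    rw [hr] at hx
    exact mul_nonneg (by positivity) (Finset.prod_nonneg fun i _ => pow_nonneg (hD hx i) _)

/-! ## Positive instance: the ordered open simplex is `Φₘ`-stable -/

/-- The ordered open simplex `{t | 0 < tᵢ < 1, t strictly decreasing}` (the MZV / iterated-integral
chain; literally the domain of `OctahedralSymmetry.SimplexDilationMove`). [folklore] -/
def orderedSimplex (n : ℕ) : Set (Fin n → ℝ) :=
  {t | (∀ i, 0 < t i) ∧ (∀ i, t i < 1) ∧ StrictAnti t}

/-- `Φₘ '' Δ = Δ` for the ordered open simplex, `m ≥ 1` (`t ↦ t^m` and `t ↦ t^(1/m)` are strictly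
increasing on `(0,1)` and fix `0, 1`). [folklore] -/
theorem image_powMap_orderedSimplex {n m : ℕ} (hm : 1 ≤ m) :
    (fun x : Fin n → ℝ => fun i => x i ^ m) '' orderedSimplex n = orderedSimplex n := by
  have hm0 : m ≠ 0 := by omega
  ext y
  simp only [mem_image, orderedSimplex, mem_setOf_eq]
  constructor
  · rintro ⟨x, ⟨hpos, hlt, hanti⟩, rfl⟩
    refine ⟨fun i => pow_pos (hpos i) m, fun i => pow_lt_one₀ (hpos i).le (hlt i) hm0, ?_⟩
    intro i j hij
    exact pow_lt_pow_left₀ (hanti hij) (hpos j).le hm0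
  · rintro ⟨hpos, hlt, hanti⟩
    refine ⟨fun i => y i ^ ((m : ℝ)⁻¹), ⟨fun i => Real.rpow_pos_of_pos (hpos i) _,
      fun i => Real.rpow_lt_one (hpos i).le (hlt i) (by positivity), ?_⟩, ?_⟩
    · intro i j hij
      exact Real.rpow_lt_rpow (hpos j).le (hanti hij) (by positivity)
    · funext i
      exact Real.rpow_inv_natCast_pow (hpos i).le hm0

/-- **The ordered simplex works** (every `n`, every `m ≥ 1`): in particular the sibling statement
`OctahedralSymmetry.SimplexDilationMove` (`m = 2`, factor `∏ 2tⱼ = 2ⁿ∏tⱼ`) is an instance.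
[Kontsevich–Zagier 2001, §1.2 (2)] -/
theorem dilationMoveOn_orderedSimplex {n m : ℕ} (hm : 1 ≤ m) : DilationMoveOn n m (orderedSimplex n) :=
  dilationMoveOn_of_image_eq hm (fun _ hx i => (hx.1 i).le) (image_powMap_orderedSimplex hm)

/-! ## Negative instance: the standard simplex is not `Φ₂`-stable, and the move fails -/

/-- The open standard 2-simplex `S = {(x, y) | 0 < x, 0 < y, x + y < 1}`. [folklore] -/
def stdSimplex2 : Set (Fin 2 → ℝ) := {x | 0 < x 0 ∧ 0 < x 1 ∧ x 0 + x 1 < 1}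

/-- `S` is `ℚ`-semialgebraic (three strict linear inequalities). [folklore] -/
theorem isSemialgebraic_stdSimplex2 : IsSemialgebraic ℚ stdSimplex2 := by
  have h0 := isSemialgebraic_setOf_eval_lt (k := ℚ) (R := ℝ) (ι := Fin 2) (C 0) (X 0)
  have h1 := isSemialgebraic_setOf_eval_lt (k := ℚ) (R := ℝ) (ι := Fin 2) (C 0) (X 1)
  have h2 := isSemialgebraic_setOf_eval_lt (k := ℚ) (R := ℝ) (ι := Fin 2) (X 0 + X 1) (C 1)
  have hEq : stdSimplex2 =
      ({x : Fin 2 → ℝ | aeval x (C 0 : MvPolynomial (Fin 2) ℚ) < aeval x (X 0 : MvPolynomial (Fin 2) ℚ)} ∩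
        {x : Fin 2 → ℝ | aeval x (C 0 : MvPolynomial (Fin 2) ℚ) < aeval x (X 1 : MvPolynomial (Fin 2) ℚ)}) ∩
      {x : Fin 2 → ℝ | aeval x (X 0 + X 1 : MvPolynomial (Fin 2) ℚ) < aeval x (C 1 : MvPolynomial (Fin 2) ℚ)} := by
    ext x
    simp [stdSimplex2, and_assoc]
  rw [hEq]
  exact (h0.inter h1).inter h2

/-- `S` is open. [folklore] -/
theorem isOpen_stdSimplex2 : IsOpen stdSimplex2 := by
  have hEq : stdSimplex2 = ({x : Fin 2 → ℝ | 0 < x 0} ∩ {x | 0 < x 1}) ∩ {x | x 0 + x 1 < 1} := by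
    ext x
    simp [stdSimplex2, and_assoc]
  rw [hEq]
  exact ((isOpen_lt continuous_const (continuous_apply 0)).inter
    (isOpen_lt continuous_const (continuous_apply 1))).inter
    (isOpen_lt ((continuous_apply 0).add (continuous_apply 1)) continuous_const)

/-- `S ⊆ [0,1]²`. [folklore] -/
theorem stdSimplex2_subset_Icc : stdSimplex2 ⊆ Icc (0 : Fin 2 → ℝ) 1 := by
  intro x hx
  obtain ⟨h0, h1, h2⟩ := hx
  refine ⟨fun i => ?_, fun i => ?_⟩
  · revert i
    rw [Fin.forall_fin_two]
    exact ⟨h0.le, h1.le⟩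
  · revert i
    rw [Fin.forall_fin_two]
    simp only [Pi.one_apply]
    constructor <;> linarith

/-- `S` has positive area (it is open and contains `(1/4, 1/4)`). [folklore] -/
theorem volume_stdSimplex2_pos : 0 < volume stdSimplex2 := by
  refine isOpen_stdSimplex2.measure_pos volume ⟨fun _ => 1 / 4, ?_⟩
  simp only [stdSimplex2, mem_setOf_eq]
  norm_num

/-- The representations `[S, c·(xy)^k]` (`c ∈ ℚ`). [folklore] -/
def simplexRep (c : ℚ) (k : ℕ) : KZ.IntegralRep 2 where
  domain := stdSimplex2
  integrand := fun x => (c : ℝ) * (x 0 * x 1) ^ k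
  isSemialgebraic_domain := isSemialgebraic_stdSimplex2
  isSemialgebraicFunOn_integrand :=
    (isSemialgebraicFunOn_aeval isSemialgebraic_stdSimplex2 (C c * (X 0 * X 1) ^ k)).congr
      (fun x _ => by simp)
  integrableOn := by
    have hc : Continuous fun x : Fin 2 → ℝ => (c : ℝ) * (x 0 * x 1) ^ k := by fun_prop
    exact (hc.continuousOn.integrableOn_compact isCompact_Icc).mono_set stdSimplex2_subset_Icc

/-- Auxiliary: `simplexRep_domain`. [folklore] -/
@[simp] theorem simplexRep_domain (c : ℚ) (k : ℕ) : (simplexRep c k).domain = stdSimplex2 := rfl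

/-- Auxiliary: `simplexRep_integrand`. [folklore] -/
@[simp] theorem simplexRep_integrand (c : ℚ) (k : ℕ) :
    (simplexRep c k).integrand = fun x => (c : ℝ) * (x 0 * x 1) ^ k := rfl

/-- On `S`, `4xy < 1` (`4xy ≤ (x+y)² < 1`). [folklore] -/
theorem four_mul_lt_one_of_mem {x : Fin 2 → ℝ} (hx : x ∈ stdSimplex2) : 4 * (x 0 * x 1) < 1 := by
  obtain ⟨h0, h1, h2⟩ := hx
  have hs : (x 0 + x 1) ^ 2 < 1 := pow_lt_one₀ (by linarith) h2 two_ne_zero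
  nlinarith [sq_nonneg (x 0 - x 1)]

/-- **`∫_S 4xy < ∫_S 1`, strictly** — the strict positivity of `∫_S (1 − 4xy)` on the open set `S` of
positive measure; no triangle integral is evaluated. [folklore] -/
theorem value_simplexRep_four_lt : (simplexRep 4 1).value < (simplexRep 1 0).value := by
  have hmeas : MeasurableSet stdSimplex2 := isOpen_stdSimplex2.measurableSet
  have hi4 : IntegrableOn (fun x : Fin 2 → ℝ => ((4 : ℚ) : ℝ) * (x 0 * x 1) ^ 1) stdSimplex2 :=
    (simplexRep 4 1).integrableOn
  have hi1 : IntegrableOn (fun x : Fin 2 → ℝ => ((1 : ℚ) : ℝ) * (x 0 * x 1) ^ 0) stdSimplex2 :=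
    (simplexRep 1 0).integrableOn
  have hsub : ∫ x in stdSimplex2, (((1 : ℚ) : ℝ) * (x 0 * x 1) ^ 0 - ((4 : ℚ) : ℝ) * (x 0 * x 1) ^ 1) =
      (∫ x in stdSimplex2, ((1 : ℚ) : ℝ) * (x 0 * x 1) ^ 0) -
        ∫ x in stdSimplex2, ((4 : ℚ) : ℝ) * (x 0 * x 1) ^ 1 :=
    integral_sub hi1 hi4
  have hpos : ∀ x ∈ stdSimplex2,
      0 < ((1 : ℚ) : ℝ) * (x 0 * x 1) ^ 0 - ((4 : ℚ) : ℝ) * (x 0 * x 1) ^ 1 := by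
    intro x hx
    have h := four_mul_lt_one_of_mem hx
    push_cast
    linarith
  have hae : 0 ≤ᵐ[volume.restrict stdSimplex2]
      fun x : Fin 2 → ℝ => ((1 : ℚ) : ℝ) * (x 0 * x 1) ^ 0 - ((4 : ℚ) : ℝ) * (x 0 * x 1) ^ 1 :=
    (ae_restrict_mem hmeas).mono fun x hx => (hpos x hx).le
  have hint : 0 < ∫ x in stdSimplex2,
      (((1 : ℚ) : ℝ) * (x 0 * x 1) ^ 0 - ((4 : ℚ) : ℝ) * (x 0 * x 1) ^ 1) := by
    rw [setIntegral_pos_iff_support_of_nonneg_ae hae (hi1.sub hi4)]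
    have hS : Function.support
        (fun x : Fin 2 → ℝ => ((1 : ℚ) : ℝ) * (x 0 * x 1) ^ 0 - ((4 : ℚ) : ℝ) * (x 0 * x 1) ^ 1) ∩
          stdSimplex2 = stdSimplex2 :=
      inter_eq_right.2 fun x hx => Function.mem_support.2 (hpos x hx).ne'
    rw [hS]
    exact volume_stdSimplex2_pos
  rw [hsub] at hint
  rw [KZ.IntegralRep.value, KZ.IntegralRep.value, simplexRep_domain, simplexRep_domain,
    simplexRep_integrand, simplexRep_integrand]
  linarith

/-- **The standard simplex is NOT a valid equal-domain dilation already at `(n, m) = (2, 2)`.**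
`r' = [S, 1]` and `r = [S, 4xy]` satisfy `r.integrand x = r'.integrand (x², y²) · 2²·xy` on `S`, yet
`r.value < r'.value` (`value_simplexRep_four_lt`), so `[r] − [r']` is no change-of-variables generator
(soundness). Root cause: `Φ₂ '' S = {√u + √v < 1} ≠ S`. [folklore] -/
theorem not_dilationMoveOn_stdSimplex_two_two : ¬ DilationMoveOn 2 2 stdSimplex2 := by
  intro h
  have hmem := h (simplexRep 4 1) (simplexRep 1 0) rfl rfl (fun x _ => by
    simp [Fin.prod_univ_two]
    norm_num)
  exact (ne_of_lt value_simplexRep_four_lt) (value_eq_of_mem hmem)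

/-- Hence the equal-domain dilation is NOT valid for every semialgebraic domain in the open orthant
(contrast `dilationMoveOn_of_image_eq`): the image clause `r'.domain = Φₘ '' r.domain` of the picked
line's `stub_orthantCoordPowMove` cannot be replaced by `r'.domain = r.domain`. [folklore] -/
theorem not_forall_dilationMoveOn_orthant :
    ¬ ∀ (n m : ℕ), 1 ≤ m → ∀ D : Set (Fin n → ℝ), D ⊆ {x | ∀ i, 0 < x i} → DilationMoveOn n m D := by
  intro h
  refine not_dilationMoveOn_stdSimplex_two_two (h 2 2 (by norm_num) stdSimplex2 fun x hx i => ?_)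
  obtain ⟨h0, h1, _⟩ := hx
  fin_cases i
  · exact h0
  · exact h1


end Summit.KontsevichZagierPeriods.KontsevichZagierPeriods.Cruxes.DilationMove.Disproof

end
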